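import Summits.CriticalPhenomena.PercolationContinuityZ3.Theorems.Transplant.FKDoubleFanMultifanBA
import Summits.CriticalPhenomena.PercolationContinuityZ3.Theorems.Transplant.FKDoubleFanSetLevel
import HarnessLib

/-!
# Double fans `K₂ ∨ P_{m+1}`: FAN EXCHANGE — the cone of `b`-fan-then-`a`-fan images (`coneBA`) against the MULTIFAN₁ cone (`coneAB`);
# `coneBA ⊆ coneAB` ALONE gives every middle of spoke pattern B·A·B (in particular every cross-apex pair at rim distance `≤ 3` with
# arbitrary weights), and `coneAB = coneBA` gives `HypAC`, hence the far cross-apex theorem for every middle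

Helper file (`--supports stmt-CriticalPhenomena-4575`), FK sub-lane `prim-bschramm-fk-3` (gen 46); builds on p205010 (kernel theorem, internal
audit signed; external expert review pending).  No named facts, no sorries; standard axioms.  Memo `bschramm/prim-bschramm-fk-3/FAR-CROSS-XXI.md`.

THE TWO DEPTH-2 CONES.  `…MultifanCone` has the MULTIFAN₁ images **`imgAB q F G u`** `= ∧²(G_b F_a)(u ∧ P_a u)` (`a`-gadget first) and their
closed convex cone `coneAB q` (bi-dual over `InKE` legs): it contains the inputs, is stable under `b`-spokes and rim steps UNCONDITIONALLY
(both are absorbed into `G`), pairs `≥ 0` with every target (MULTIFAN₁), and the single open hypothesis of that route is `a`-stability (`HypAC`).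
This file introduces the mirror-ordered images **`imgBA q F G u`** `= ∧²(F_a G_b)(u ∧ P_a u)` (`b`-gadget FIRST — the bivector of
`baZ_rayleigh_eq_pairH`, `…MultifanBA`), their dual **`DualBA`** and bi-dual cone **`coneBA`**.  Dually to `coneAB`, the cone `coneBA` contains the
inputs and is stable under `a`-spokes and rim steps UNCONDITIONALLY (`opAC_imgBA`, `opE_imgBA` — absorbed into `F`; **`DualBA.ac`**, **`DualBA.rim`**,
**`coneBA_opAC`**, **`coneBA_opE`**), while "targets ∈ `DualBA`" is exactly LEMMA‴-BA (**`lemmaBA_iff_target_dualBA`**).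
FAN EXCHANGE.  **`HypBA q`**: every BA image lies in `coneAB` (⟺ `coneBA ⊆ coneAB`, **`hypBA_iff`**); **`HypAB q`**: every AB image lies in
`coneBA` (⟺ `coneAB ⊆ coneBA`).  Results (`0 < q ≤ 1`):
* **`lemmaBA_of_hypBA`**: `HypBA ⟹` LEMMA‴-BA (targets are dual to `coneAB` by MULTIFAN₁);
* **`dualAB_bTarget`**: the `b`-fan-transported targets `(G₂ʳᵉᵛ(s∗BC_0)) ∧ (G₂ʳᵉᵛ(s∗BC_1))` lie in `DualAB` UNCONDITIONALLY (series composition of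
  `b`-fans, `fanComboB_fanVecB`, + MULTIFAN₁) — so `coneAB` pairs `≥ 0` with them;
* **`negCorr_spokes_cross_far_bab_of_hypBA`**, **`negCorr_spokes_cross_far_babj_of_hypBA`**: `HypBA` ALONE ⟹ negative correlation of
  `(a c_j, b c_k)` for EVERY middle of spoke pattern B·A·B (a run of `b`-only vertices, a JUNCTION vertex with both spokes, a run of `a`-only
  vertices, a second junction vertex, a run of `b`-only vertices; rim steps anywhere — the two spokes of one vertex commute, `…MultifanJunction`)
  — this REPLACES `negCorr_spokes_cross_far_bab_of_hypA` of `…MultifanBA`, whose hypothesis `HypA` is refuted for every `q` (`not_hypA`,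
  `…TwoSidedConeSRefuted`); in particular (**`negCorr_spokes_cross_three_of_hypBA`**) EVERY cross-apex pair at rim distance `3` with ARBITRARY
  weights (distance `≤ 2` is unconditional: `negCorr_spokes_cross`, `negCorr_spokes_cross_two`);
* **`hypAC_of_hypAB_hypBA`**: `HypAB ∧ HypBA` (i.e. `coneAB = coneBA`) ⟹ `HypAC`, hence (**`negCorr_spokes_cross_far_of_fanExchange`**) the far
  cross-apex theorem for ALL middles — the cone of depth-2 images does not depend on the order of the two fans;
* set level: **`HypSetBA q`** (every BA plane `F_a G_b·span(u, P_a u)` with `InKE` legs IS a MULTIFAN₁ plane with the weak legs of `mfAtomSet`)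
  ⟹ B·A·B as well (**`negCorr_spokes_cross_far_bab_of_hypSetBA`**, `0 < q < 1`), cone-free.
NUMERICS (memo §1, kit j300281–90): the set-level exchange `F_a G_b Π_u = G'_b F'_a Π_{u'}` holds in every tested instance (72/72), with all three
legs moving (`u' = u` sometimes, `F' = F` / `G' = G` never feasible).  STATUS of `HypBA`/`HypAB`/`HypSetBA`: OPEN.
[cite: Grimmett2006, §3.9 eq. (3.94) (pp. 63–64)] [folklore]
-/

noncomputable section

namespace Summit.CriticalPhenomena.PercolationContinuityZ3.Theorems

namespace FK

namespace ThreeApex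

/-! ### BA images: `b`-gadget first, then `a`-gadget -/

/-- **The BA image**: the pair bivector after a `b`-gadget `G` and THEN an `a`-gadget `F` applied to the input pair `(AC_0∗u, AC_1∗u)`. [folklore] -/
def imgBA (q : ℝ) (F G u : V5) : Biv :=
  wedgeH (fanCombo q F (fanComboB q G (conv (edgeAC 0) u))) (fanCombo q F (fanComboB q G (conv (edgeAC 1) u)))

/-- With a trivial `a`-gadget the BA image is the `b`-image; with a trivial `b`-gadget, the `a`-image. [folklore] -/
theorem imgBA_fanInit (q : ℝ) (F G u : V5) : imgBA q fanInit G u = imgB q G u ∧ imgBA q F fanInit u = imgA q F u := by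
  constructor <;> simp only [imgBA, imgB, imgA, fanCombo_init, fanComboB_init]

/-- With both gadgets trivial the BA image is the input. [folklore] -/
theorem imgBA_init (q : ℝ) (u : V5) : imgBA q fanInit fanInit u = wedgeH (conv (edgeAC 0) u) (conv (edgeAC 1) u) := by
  simp only [imgBA, fanComboB_init, fanCombo_init]

/-- An `a`-spoke is absorbed into the `a`-gadget: `∧²AC_x · imgBA q F G u = imgBA q (BC_x ∗ F) G u`. [folklore] -/
theorem opAC_imgBA (q x : ℝ) (F G u : V5) : opAC x (imgBA q F G u) = imgBA q (conv (edgeBC x) F) G u := by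
  simp only [imgBA, opAC_wedgeH, conv_edgeAC_fanCombo]

/-- A rim step is absorbed into the `a`-gadget: `∧²E_r · imgBA q F G u = imgBA q (E_r F) G u`. [folklore] -/
theorem opE_imgBA (q r : ℝ) (F G u : V5) : opE q r (imgBA q F G u) = imgBA q (rimStep q r F) G u := by
  simp only [imgBA, opE_wedgeH, rimStep_fanCombo]

/-- **The BA four-leg Rayleigh difference is the pairing of the BA image with the target** (`baZ` of `…MultifanBA`). [folklore] -/
theorem baZ_rayleigh_eq_pairH_imgBA (q : ℝ) (F G u s : V5) :
    baZ q F G u s 1 0 * baZ q F G u s 0 1 - baZ q F G u s 1 1 * baZ q F G u s 0 0 =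
      q ^ 2 * pairH q (imgBA q F G u) (wedgeH (conv s (edgeBC 0)) (conv s (edgeBC 1))) :=
  baZ_rayleigh_eq_pairH q F G u s

/-! ### The BA dual and bi-dual -/

/-- The dual of the BA images over `InKE`: bivectors pairing `≥ 0` with every `imgBA q F G u`, `F, G, u ∈ InKE q`. [folklore] -/
@[folklore] def DualBA (q : ℝ) (γ : Biv) : Prop := ∀ F G u : V5, InKE q F → InKE q G → InKE q u → 0 ≤ pairH q (imgBA q F G u) γ

/-- **The BA cone**: the closed convex cone bi-dual to the BA images. [folklore] -/
def coneBA (q : ℝ) : Set Biv := {β | ∀ γ : Biv, DualBA q γ → 0 ≤ pairH q β γ}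

/-- BA images lie in the BA cone. [folklore] -/
theorem imgBA_mem_coneBA {q : ℝ} {F G u : V5} (hF : InKE q F) (hG : InKE q G) (hu : InKE q u) : imgBA q F G u ∈ coneBA q :=
  fun _ hγ => hγ F G u hF hG hu

/-- Inputs lie in the BA cone (`u ∈ InKE q`). [folklore] -/
theorem input_mem_coneBA {q : ℝ} {u : V5} (hu : InKE q u) : wedgeH (conv (edgeAC 0) u) (conv (edgeAC 1) u) ∈ coneBA q := by
  rw [← imgBA_init]; exact imgBA_mem_coneBA (fanInit_inKE q) (fanInit_inKE q) hu

namespace DualBA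

variable {q : ℝ} {γ : Biv}

/-- The BA dual is stable under `a`-spokes (unconditionally). [folklore] -/
theorem ac (hγ : DualBA q γ) {x : ℝ} (hx0 : 0 ≤ x) (hx1 : x ≤ 1) : DualBA q (opAC x γ) := fun F G u hF hG hu => by
  rw [← pairH_opAC, opAC_imgBA]; exact hγ _ G u (InKE.step (IsLetter.bc hx0 hx1) hF) hG hu

/-- The BA dual is stable under rim steps (unconditionally). [folklore] -/
theorem rim (hγ : DualBA q γ) {r : ℝ} (hr0 : 0 ≤ r) (hr1 : r ≤ 1) : DualBA q (opE q r γ) := fun F G u hF hG hu => by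
  rw [← pairH_opE, opE_imgBA]; exact hγ _ G u (InKE.rim hr0 hr1 hF) hG hu

end DualBA

/-- The BA cone is stable under `a`-spokes (unconditionally). [folklore] -/
theorem coneBA_opAC {q : ℝ} {β : Biv} (hβ : β ∈ coneBA q) {x : ℝ} (hx0 : 0 ≤ x) (hx1 : x ≤ 1) : opAC x β ∈ coneBA q :=
  fun γ hγ => by rw [pairH_opAC]; exact hβ _ (hγ.ac hx0 hx1)

/-- The BA cone is stable under rim steps (unconditionally). [folklore] -/
theorem coneBA_opE {q : ℝ} {β : Biv} (hβ : β ∈ coneBA q) {r : ℝ} (hr0 : 0 ≤ r) (hr1 : r ≤ 1) : opE q r β ∈ coneBA q :=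
  fun γ hγ => by rw [pairH_opE]; exact hβ _ (hγ.rim hr0 hr1)

/-- The MULTIFAN₁ cone is stable under `b`-spokes (unconditionally; from `DualAB.bc`). [folklore] -/
theorem coneAB_opBC {q : ℝ} {β : Biv} (hβ : β ∈ coneAB q) {y : ℝ} (hy0 : 0 ≤ y) (hy1 : y ≤ 1) : opBC y β ∈ coneAB q :=
  fun γ hγ => by rw [pairH_opBC]; exact hβ _ (hγ.bc hy0 hy1)

/-- The MULTIFAN₁ cone is stable under rim steps (unconditionally; from `DualAB.rim`). [folklore] -/
theorem coneAB_opE {q : ℝ} {β : Biv} (hβ : β ∈ coneAB q) {r : ℝ} (hr0 : 0 ≤ r) (hr1 : r ≤ 1) : opE q r β ∈ coneAB q :=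
  fun γ hγ => by rw [pairH_opE]; exact hβ _ (hγ.rim hr0 hr1)

/-- **LEMMA‴-BA ⟺ every target lies in the BA dual** (by `baZ_rayleigh_eq_pairH_imgBA`; `0 < q`). [folklore] -/
theorem lemmaBA_iff_target_dualBA {q : ℝ} (hq0 : 0 < q) :
    (∀ F G u s : V5, InKE q F → InKE q G → InKE q u → InKE q s →
        0 ≤ baZ q F G u s 1 0 * baZ q F G u s 0 1 - baZ q F G u s 1 1 * baZ q F G u s 0 0) ↔
      ∀ s : V5, InKE q s → DualBA q (wedgeH (conv s (edgeBC 0)) (conv s (edgeBC 1))) := by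
  have hq2 : (0 : ℝ) < q ^ 2 := pow_pos hq0 2
  constructor
  · intro h s hs F G u hF hG hu
    have key := h F G u s hF hG hu hs
    rw [baZ_rayleigh_eq_pairH_imgBA] at key
    exact (mul_nonneg_iff_of_pos_left hq2).mp key
  · intro h F G u s hF hG hu hs
    rw [baZ_rayleigh_eq_pairH_imgBA]
    exact mul_nonneg hq2.le (h s hs F G u hF hG hu)

/-! ### The fan-exchange hypotheses -/

/-- **`HypBA`**: every BA image lies in the MULTIFAN₁ cone `coneAB` — "a `b`-fan followed by an `a`-fan is, at cone level, an `a`-fan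
followed by a `b`-fan". [folklore] -/
@[folklore] def HypBA (q : ℝ) : Prop := ∀ F G u : V5, InKE q F → InKE q G → InKE q u → imgBA q F G u ∈ coneAB q

/-- **`HypAB`**: every MULTIFAN₁ image lies in the BA cone `coneBA`. [folklore] -/
@[folklore] def HypAB (q : ℝ) : Prop := ∀ F G u : V5, InKE q F → InKE q G → InKE q u → imgAB q F G u ∈ coneBA q

/-- Under `HypBA` the MULTIFAN₁ dual is contained in the BA dual. [folklore] -/
theorem DualAB.dualBA {q : ℝ} (h : HypBA q) {γ : Biv} (hγ : DualAB q γ) : DualBA q γ :=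
  fun F G u hF hG hu => h F G u hF hG hu γ hγ

/-- Under `HypAB` the BA dual is contained in the MULTIFAN₁ dual. [folklore] -/
theorem DualBA.dualAB {q : ℝ} (h : HypAB q) {γ : Biv} (hγ : DualBA q γ) : DualAB q γ :=
  fun F G u hF hG hu => h F G u hF hG hu γ hγ

/-- **`HypBA ⟺ coneBA ⊆ coneAB`.** [folklore] -/
theorem hypBA_iff {q : ℝ} : HypBA q ↔ coneBA q ⊆ coneAB q :=
  ⟨fun h _ hβ γ hγ => hβ γ (hγ.dualBA h), fun h _ _ _ hF hG hu => h (imgBA_mem_coneBA hF hG hu)⟩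

/-- **`HypAB ⟺ coneAB ⊆ coneBA`.** [folklore] -/
theorem hypAB_iff {q : ℝ} : HypAB q ↔ coneAB q ⊆ coneBA q :=
  ⟨fun h _ hβ γ hγ => hβ γ (hγ.dualAB h), fun h _ _ _ hF hG hu => h (imgAB_mem_coneAB hF hG hu)⟩

/-- **`HypBA ⟹` LEMMA‴-BA** (`0 < q ≤ 1`): the BA four-leg inequality `baZ¹⁰baZ⁰¹ − baZ¹¹baZ⁰⁰ ≥ 0` on `InKE⁴` — targets are dual to `coneAB` by
MULTIFAN₁ (`target_dualAB`). [folklore] -/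
theorem lemmaBA_of_hypBA {q : ℝ} (hq0 : 0 < q) (hq1 : q ≤ 1) (h : HypBA q) :
    ∀ F G u s : V5, InKE q F → InKE q G → InKE q u → InKE q s →
      0 ≤ baZ q F G u s 1 0 * baZ q F G u s 0 1 - baZ q F G u s 1 1 * baZ q F G u s 0 0 :=
  (lemmaBA_iff_target_dualBA hq0).2 fun _ hs => (target_dualAB hq0 hq1 hs).dualBA h

/-- **FAN EXCHANGE ⟹ `HypAC`**: if `coneAB = coneBA` (`HypAB ∧ HypBA`), an `a`-spoke keeps every MULTIFAN₁ image in `coneAB`: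
`∧²AC_x·imgAB ∈ ∧²AC_x·coneBA ⊆ coneBA ⊆ coneAB`. [folklore] -/
theorem hypAC_of_hypAB_hypBA {q : ℝ} (hAB : HypAB q) (hBA : HypBA q) : HypAC q :=
  fun F G u _ hF hG hu hx0 hx1 => hypBA_iff.1 hBA (coneBA_opAC (hAB F G u hF hG hu) hx0 hx1)

/-! ### `b`-fan-transported targets are dual to the MULTIFAN₁ cone (unconditionally) -/

/-- Reassociation `Y ∗ (BC_τ ∗ X) = (Y ∗ BC_τ) ∗ X` is `conv_conv_edgeBC_assoc`; here the series composition of the OUTER `b`-fan `G₂ = E_{rd}·fanVecB mb`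
with an arbitrary `b`-gadget `G`: `fanComboB G₂ (fanComboB G V) = fanComboB (E_{rd}(fanVecB q mb G)) V`. [folklore] -/
theorem fanComboB_series (q : ℝ) {mb : List (ℝ × ℝ × ℝ)} (hb : ∀ blk ∈ mb, blk.2.1 = 0) (rd : ℝ) (G V : V5) :
    fanComboB q (rimStep q rd (fanVecB q mb fanInit)) (fanComboB q G V) = fanComboB q (rimStep q rd (fanVecB q mb G)) V := by
  rw [← rimStep_fanComboB, fanComboB_fanVecB q hb, rimStep_fanComboB]

/-- **The `b`-fan-transported targets lie in the MULTIFAN₁ dual** (`0 < q ≤ 1`): for a `b`-only block list `mb` (weights in `[0,1]`), a last rim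
weight `rd ∈ [0,1]` and `s ∈ InKE q`, with `G₂ = E_{rd}(fanVecB q mb fanInit)`, the bivector `(G₂ʳᵉᵛ(s∗BC_0)) ∧ (G₂ʳᵉᵛ(s∗BC_1))` pairs `≥ 0` with
every `imgAB q F G w` — this is MULTIFAN₁ for the composed `b`-gadget `E_{rd}(fanVecB q mb G) ∈ InKE q`. [folklore] -/
theorem dualAB_bTarget {q : ℝ} (hq0 : 0 < q) (hq1 : q ≤ 1) {mb : List (ℝ × ℝ × ℝ)} (hmb : UnitBlocks mb) (hb : ∀ blk ∈ mb, blk.2.1 = 0)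
    {rd : ℝ} (hrd0 : 0 ≤ rd) (hrd1 : rd ≤ 1) {s : V5} (hs : InKE q s) :
    DualAB q (wedgeH (fanComboBrev q (rimStep q rd (fanVecB q mb fanInit)) (conv s (edgeBC 0)))
      (fanComboBrev q (rimStep q rd (fanVecB q mb fanInit)) (conv s (edgeBC 1)))) := by
  set G₂ := rimStep q rd (fanVecB q mb fanInit) with hG₂
  have hq2 : (0 : ℝ) < q ^ 2 := pow_pos hq0 2
  intro F G w hF hG hw
  have hG'' : InKE q (rimStep q rd (fanVecB q mb G)) := InKE.rim hrd0 hrd1 (fanVecB_inKE hmb hG)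
  have e : ∀ σ τ : ℝ, mfZ q F (rimStep q rd (fanVecB q mb G)) w s σ τ =
      val q (conv (fanComboBrev q G₂ (conv s (edgeBC τ))) (fanComboB q G (fanCombo q F (conv (edgeAC σ) w)))) := by
    intro σ τ
    rw [mfZ, conv_conv_edgeBC_assoc, ← fanComboB_series q hb rd G, val_conv_fanComboB]
  have key := mfRay_nonneg_inKE hq0 hq1 F _ w s hF hG'' hw hs
  rw [e, e, e, e, rayleigh_eq_pairH'] at key
  simp only [imgAB]
  exact (mul_nonneg_iff_of_pos_left hq2).mp key

/-- The same transported targets for an ATOM with weak legs (`F ∈ LegF`, `G ∈ InS`, `u ∈ LegU`, `0 < q < 1`): `InS` is closed under `b`-fans. [folklore] -/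
theorem InS.fanVecB {q : ℝ} (hq0 : 0 < q) (hq1 : q ≤ 1) :
    ∀ {l : List (ℝ × ℝ × ℝ)}, UnitBlocks l → ∀ {G : V5}, InS q G → InS q (ThreeApex.fanVecB q l G) := by
  intro l
  induction l with
  | nil => intro _ G hG; simpa [ThreeApex.fanVecB] using hG
  | cons blk rest ih =>
    intro hl G hG
    have hbk := hl blk (by simp)
    have hrest : UnitBlocks rest := fun b hb' => hl b (by simp [hb'])
    simp only [ThreeApex.fanVecB]
    exact ih hrest (InS.step hq0 hq1 (IsLetter.bc hbk.2.2.2.2.1 hbk.2.2.2.2.2) (hG.rimStep hq0 hq1 hbk.1 hbk.2.1))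

/-- **The `b`-fan-transported targets pair `≥ 0` with every atom of `mfAtomSet`** (`0 < q < 1`). [folklore] -/
theorem pairH_mfAtomSet_bTarget {q : ℝ} (hq0 : 0 < q) (hq1 : q < 1) {mb : List (ℝ × ℝ × ℝ)} (hmb : UnitBlocks mb)
    (hb : ∀ blk ∈ mb, blk.2.1 = 0) {rd : ℝ} (hrd0 : 0 ≤ rd) (hrd1 : rd ≤ 1) {s : V5} (hs : InKE q s) :
    ∀ β, β ∈ mfAtomSet q → 0 ≤ pairH q β (wedgeH (fanComboBrev q (rimStep q rd (fanVecB q mb fanInit)) (conv s (edgeBC 0)))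
      (fanComboBrev q (rimStep q rd (fanVecB q mb fanInit)) (conv s (edgeBC 1)))) := by
  set G₂ := rimStep q rd (fanVecB q mb fanInit) with hG₂
  have hq2 : (0 : ℝ) < q ^ 2 := pow_pos hq0 2
  rintro β ⟨c, F, G, u, hc, hF, hG, hu, rfl⟩
  rw [pairH_smul_left]
  refine mul_nonneg hc ?_
  have hG'' : InS q (rimStep q rd (fanVecB q mb G)) := (InS.fanVecB hq0 hq1.le hmb hG).rimStep hq0 hq1.le hrd0 hrd1
  have e : ∀ σ τ : ℝ, mfZ q F (rimStep q rd (fanVecB q mb G)) u s σ τ =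
      val q (conv (fanComboBrev q G₂ (conv s (edgeBC τ))) (fanComboB q G (fanCombo q F (conv (edgeAC σ) u)))) := by
    intro σ τ
    rw [mfZ, conv_conv_edgeBC_assoc, ← fanComboB_series q hb rd G, val_conv_fanComboB]
  have key := mfRay_nonneg_of_goodIJ hq0 hq1 (goodIJ_endpoints hq0.le hq1.le) hF.1 hF.2 hG''.valid.nonneg hG''.ua hu.1 hu.2
    (hs.valid hq0.le hq1.le).nonneg (hs.uCond hq0 hq1.le)
  rw [mfRay, e, e, e, e, rayleigh_eq_pairH'] at key
  simp only [imgAB]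
  exact (mul_nonneg_iff_of_pos_left hq2).mp key

/-! ### Set-level fan exchange -/

/-- **`HypSetBA`** (set-level fan exchange): every BA plane with `InKE` legs is a non-negative multiple of ONE MULTIFAN₁ image with the weak legs
of `mfAtomSet` — `F_a G_b · span(u, P_a u) = G'_b F'_a · span(u', P_a u')` as oriented planes. [folklore] -/
@[folklore] def HypSetBA (q : ℝ) : Prop := ∀ F G u : V5, InKE q F → InKE q G → InKE q u → imgBA q F G u ∈ mfAtomSet q

/-! ### The B·A·B bookkeeping -/

/-- The B·A·B bookkeeping shared by the cone-level and the set-level theorem: with the three runs `mb₁` (`b`-only), `ma` (`a`-only), `mb₂` (`b`-only)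
of the middle block list, the four pinned partition functions are `val((G₂ʳᵉᵛ(s∗BC_τ)) ∗ X_σ)` with `X_σ = fanCombo F (fanComboB G₁ (AC_σ∗u))`,
`F = fanVec q ma fanInit`, `G₁ = fanVecB q mb₁ fanInit`, `G₂ = E_{rd}(fanVecB q mb₂ fanInit)` — and `X_0 ∧ X_1 = imgBA q F G₁ u`. [folklore] -/
theorem crossFarZ_bab (q : ℝ) {mb₁ ma mb₂ : List (ℝ × ℝ × ℝ)} (hx1 : ∀ blk ∈ mb₁, blk.2.1 = 0) (hy2 : ∀ blk ∈ ma, blk.2.2 = 0)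
    (hx3 : ∀ blk ∈ mb₂, blk.2.1 = 0) (rd : ℝ) (u s : V5) (σ τ : ℝ) :
    crossFarZ q ((mb₁ ++ ma) ++ mb₂) rd u s σ τ =
      val q (conv (fanComboBrev q (rimStep q rd (fanVecB q mb₂ fanInit)) (conv s (edgeBC τ)))
        (fanCombo q (fanVec q ma fanInit) (fanComboB q (fanVecB q mb₁ fanInit) (conv (edgeAC σ) u)))) := by
  simp only [crossFarZ, midWord_appendList]
  rw [midWord_oneSidedB_init q hx1, midWord_oneSided_init q hy2, midWord_oneSidedB_init q hx3, rimStep_fanComboB,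
    conv_conv_edgeBC_assoc, val_conv_fanComboB]

/-! ### Measure level -/

open MeasureTheory Literature.Probability.LatticeModels Literature.Probability.Percolation
open scoped Classical

variable {V : Type*} [Fintype V]

section Setting

variable {a b : V} {c : ℕ → V} {m : ℕ}
variable (hab : a ≠ b) (hinj : ∀ j k, j ≤ m → k ≤ m → c j = c k → j = k) (hca : ∀ j, j ≤ m → c j ≠ a) (hcb : ∀ j, j ≤ m → c j ≠ b)
include hab hinj hca hcb

/-- **FAN EXCHANGE ⟹ NEGATIVE CORRELATION OF EVERY CROSS-APEX PAIR AT EVERY DISTANCE** (`0 < q ≤ 1`): if `coneAB q = coneBA q`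
(`HypAB q ∧ HypBA q`), then for every weighted double fan (`card V = m + 3`, weights supported on the double-fan pairs) and all `j < k ≤ m`:
`φ(J_{a c_j} ∩ J_{b c_k}) ≤ φ(J_{a c_j})·φ(J_{b c_k})`. [folklore] -/
theorem negCorr_spokes_cross_far_of_fanExchange (hcard : Fintype.card V = m + 3) {q : ℝ} (hq0 : 0 < q) (hq1 : q ≤ 1)
    (w : Sym2 V → unitInterval) (hsupp : ∀ e, e ∉ dfPairs a b c m → w e = 0) (hAB : HypAB q) (hBA : HypBA q) {j k : ℕ} (hjk : j < k)
    (hk : k ≤ m) :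
    (rcMeasureW w q ∅).real ({ω : BondConfig V | s(a, c j) ∈ ω} ∩ {ω | s(b, c k) ∈ ω}) ≤
      (rcMeasureW w q ∅).real {ω : BondConfig V | s(a, c j) ∈ ω} * (rcMeasureW w q ∅).real {ω : BondConfig V | s(b, c k) ∈ ω} :=
  negCorr_spokes_cross_far_of_hypAC hab hinj hca hcb hcard hq0 hq1 w hsupp (hypAC_of_hypAB_hypBA hAB hBA) hjk hk

/-- **`HypBA` ALONE ⟹ NEGATIVE CORRELATION FOR EVERY MIDDLE OF SPOKE PATTERN "B·A·B"** (`0 < q ≤ 1`): for every weighted double fan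
(`card V = m + 3`, weights supported on the double-fan pairs) and all `j ≤ ℓ₁ ≤ ℓ₂ < k ≤ m` with `w(a c_i) = 0` for `j < i ≤ ℓ₁`, `w(b c_i) = 0`
for `ℓ₁ < i ≤ ℓ₂` and `w(a c_i) = 0` for `ℓ₂ < i < k` (middle `b`-spokes, then `a`-spokes, then `b`-spokes; rim steps anywhere), the pair
`(a c_j, b c_k)` is negatively correlated.  Proof: the input-side bivector is `imgBA q F G₁ u ∈ coneAB` (`HypBA`), the target side is
`b`-fan-transported into `DualAB` (`dualAB_bTarget`, unconditional). [folklore] -/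
theorem negCorr_spokes_cross_far_bab_of_hypBA (hcard : Fintype.card V = m + 3) {q : ℝ} (hq0 : 0 < q) (hq1 : q ≤ 1)
    (w : Sym2 V → unitInterval) (hsupp : ∀ e, e ∉ dfPairs a b c m → w e = 0) (hBA : HypBA q)
    {j ℓ₁ ℓ₂ k : ℕ} (hj1 : j ≤ ℓ₁) (h12 : ℓ₁ ≤ ℓ₂) (h2k : ℓ₂ < k) (hk : k ≤ m)
    (ha1 : ∀ i, j < i → i ≤ ℓ₁ → w s(a, c i) = 0) (hb2 : ∀ i, ℓ₁ < i → i ≤ ℓ₂ → w s(b, c i) = 0)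
    (ha3 : ∀ i, ℓ₂ < i → i < k → w s(a, c i) = 0) :
    (rcMeasureW w q ∅).real ({ω : BondConfig V | s(a, c j) ∈ ω} ∩ {ω | s(b, c k) ∈ ω}) ≤
      (rcMeasureW w q ∅).real {ω : BondConfig V | s(a, c j) ∈ ω} * (rcMeasureW w q ∅).real {ω : BondConfig V | s(b, c k) ∈ ω} := by
  obtain ⟨d, rfl⟩ : ∃ d, k = j + d + 1 := ⟨k - j - 1, by omega⟩
  refine negCorr_spokes_cross_far_of_rayleigh hab hinj hca hcb hcard hq0 w hsupp hk ?_
  have huK : InKE q (conv (edgeBC (wR w s(b, c j))) (blockIn q w a b c j)) :=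
    InKE.step (IsLetter.bc (w _).2.1 (w _).2.2) (inKE_blockIn q w a b c j)
  have hsK : InKE q (conv (restVec q w a b c (j + d + 1) (m - (j + d + 1))) (edgeAC (wR w s(a, c (j + d + 1))))) :=
    InKE.mul (inKE_restVec q w a b c (m - (j + d + 1)) (j + d + 1)) (by
      rw [← mul_one (edgeAC (wR w s(a, c (j + d + 1)))), mul_def, one_def]
      exact InKE.step (IsLetter.ac (w _).2.1 (w _).2.2) InKE.base)
  set n₁ := ℓ₁ - j with hn₁
  set n₂ := ℓ₂ - ℓ₁ with hn₂
  obtain ⟨n₃, hn₃⟩ : ∃ n₃, d = (n₁ + n₂) + n₃ := ⟨d - (n₁ + n₂), by omega⟩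
  have hsplit : midBlocks w a b c j d =
      (midBlocks w a b c j n₁ ++ midBlocks w a b c (j + n₁) n₂) ++ midBlocks w a b c (j + (n₁ + n₂)) n₃ := by
    rw [hn₃, midBlocks_split w a b c j (n₁ + n₂) n₃, midBlocks_split w a b c j n₁ n₂]
  have hx1 : ∀ blk ∈ midBlocks w a b c j n₁, blk.2.1 = 0 :=
    midBlocks_aSpoke_zero w a b c j n₁ (fun i hi hi' => ha1 i hi (by omega))
  have hy2 : ∀ blk ∈ midBlocks w a b c (j + n₁) n₂, blk.2.2 = 0 :=
    midBlocks_bSpoke_zero w a b c (j + n₁) n₂ (fun i hi hi' => hb2 i (by omega) (by omega))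
  have hx3 : ∀ blk ∈ midBlocks w a b c (j + (n₁ + n₂)) n₃, blk.2.1 = 0 :=
    midBlocks_aSpoke_zero w a b c (j + (n₁ + n₂)) n₃ (fun i hi hi' => ha3 i (by omega) (by omega))
  set mb₁ := midBlocks w a b c j n₁
  set ma := midBlocks w a b c (j + n₁) n₂
  set mb₂ := midBlocks w a b c (j + (n₁ + n₂)) n₃
  set rd := wR w s(c (j + d), c (j + d + 1))
  set u := conv (edgeBC (wR w s(b, c j))) (blockIn q w a b c j)
  set s := conv (restVec q w a b c (j + d + 1) (m - (j + d + 1))) (edgeAC (wR w s(a, c (j + d + 1))))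
  have hrd0 : 0 ≤ rd := (w _).2.1
  have hrd1 : rd ≤ 1 := (w _).2.2
  set F := fanVec q ma fanInit
  set G₁ := fanVecB q mb₁ fanInit
  set G₂ := rimStep q rd (fanVecB q mb₂ fanInit)
  have hF : InKE q F := fanVec_inKE (unitBlocks_midBlocks w a b c (j + n₁) n₂) (fanInit_inKE q)
  have hG₁ : InKE q G₁ := fanVecB_inKE (unitBlocks_midBlocks w a b c j n₁) (fanInit_inKE q)
  set X : ℝ → V5 := fun σ => fanCombo q F (fanComboB q G₁ (conv (edgeAC σ) u))
  set Y : ℝ → V5 := fun τ => fanComboBrev q G₂ (conv s (edgeBC τ))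
  have hZ : ∀ σ τ : ℝ, crossFarZ q (midBlocks w a b c j d) rd u s σ τ = val q (conv (Y τ) (X σ)) := by
    intro σ τ; rw [hsplit]; exact crossFarZ_bab q hx1 hy2 hx3 rd u s σ τ
  have hmem : wedgeH (X 0) (X 1) ∈ coneAB q := hBA F G₁ u hF hG₁ huK
  have hdual : DualAB q (wedgeH (Y 0) (Y 1)) :=
    dualAB_bTarget hq0 hq1 (unitBlocks_midBlocks w a b c (j + (n₁ + n₂)) n₃) hx3 hrd0 hrd1 hsK
  have hpos : ∀ β, β ∈ coneAB q → 0 ≤ pairH q β (wedgeH (Y 0) (Y 1)) := fun β hβ => hβ _ hdual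
  have key := rayleigh_of_isOpCone hmem hpos
  have e : ∀ A B : V5, conv A B = conv B A := fun A B => by simp only [← mul_def]; ac_rfl
  simp only
  rw [hZ, hZ, hZ, hZ, e (Y 1) (X 1), e (Y 0) (X 0), e (Y 0) (X 1), e (Y 1) (X 0)]
  linarith [key]

/-- **`HypSetBA` ALONE ⟹ B·A·B** (set level, cone-free; `0 < q < 1`): same bookkeeping, with `mfAtomSet` in place of `coneAB` and
`pairH_mfAtomSet_bTarget` in place of `dualAB_bTarget`. [folklore] -/
theorem negCorr_spokes_cross_far_bab_of_hypSetBA (hcard : Fintype.card V = m + 3) {q : ℝ} (hq0 : 0 < q) (hq1 : q < 1)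
    (w : Sym2 V → unitInterval) (hsupp : ∀ e, e ∉ dfPairs a b c m → w e = 0) (hBA : HypSetBA q)
    {j ℓ₁ ℓ₂ k : ℕ} (hj1 : j ≤ ℓ₁) (h12 : ℓ₁ ≤ ℓ₂) (h2k : ℓ₂ < k) (hk : k ≤ m)
    (ha1 : ∀ i, j < i → i ≤ ℓ₁ → w s(a, c i) = 0) (hb2 : ∀ i, ℓ₁ < i → i ≤ ℓ₂ → w s(b, c i) = 0)
    (ha3 : ∀ i, ℓ₂ < i → i < k → w s(a, c i) = 0) :
    (rcMeasureW w q ∅).real ({ω : BondConfig V | s(a, c j) ∈ ω} ∩ {ω | s(b, c k) ∈ ω}) ≤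
      (rcMeasureW w q ∅).real {ω : BondConfig V | s(a, c j) ∈ ω} * (rcMeasureW w q ∅).real {ω : BondConfig V | s(b, c k) ∈ ω} := by
  obtain ⟨d, rfl⟩ : ∃ d, k = j + d + 1 := ⟨k - j - 1, by omega⟩
  refine negCorr_spokes_cross_far_of_rayleigh hab hinj hca hcb hcard hq0 w hsupp hk ?_
  have huK : InKE q (conv (edgeBC (wR w s(b, c j))) (blockIn q w a b c j)) :=
    InKE.step (IsLetter.bc (w _).2.1 (w _).2.2) (inKE_blockIn q w a b c j)
  have hsK : InKE q (conv (restVec q w a b c (j + d + 1) (m - (j + d + 1))) (edgeAC (wR w s(a, c (j + d + 1))))) :=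
    InKE.mul (inKE_restVec q w a b c (m - (j + d + 1)) (j + d + 1)) (by
      rw [← mul_one (edgeAC (wR w s(a, c (j + d + 1)))), mul_def, one_def]
      exact InKE.step (IsLetter.ac (w _).2.1 (w _).2.2) InKE.base)
  set n₁ := ℓ₁ - j with hn₁
  set n₂ := ℓ₂ - ℓ₁ with hn₂
  obtain ⟨n₃, hn₃⟩ : ∃ n₃, d = (n₁ + n₂) + n₃ := ⟨d - (n₁ + n₂), by omega⟩
  have hsplit : midBlocks w a b c j d =
      (midBlocks w a b c j n₁ ++ midBlocks w a b c (j + n₁) n₂) ++ midBlocks w a b c (j + (n₁ + n₂)) n₃ := by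
    rw [hn₃, midBlocks_split w a b c j (n₁ + n₂) n₃, midBlocks_split w a b c j n₁ n₂]
  have hx1 : ∀ blk ∈ midBlocks w a b c j n₁, blk.2.1 = 0 :=
    midBlocks_aSpoke_zero w a b c j n₁ (fun i hi hi' => ha1 i hi (by omega))
  have hy2 : ∀ blk ∈ midBlocks w a b c (j + n₁) n₂, blk.2.2 = 0 :=
    midBlocks_bSpoke_zero w a b c (j + n₁) n₂ (fun i hi hi' => hb2 i (by omega) (by omega))
  have hx3 : ∀ blk ∈ midBlocks w a b c (j + (n₁ + n₂)) n₃, blk.2.1 = 0 :=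
    midBlocks_aSpoke_zero w a b c (j + (n₁ + n₂)) n₃ (fun i hi hi' => ha3 i (by omega) (by omega))
  set mb₁ := midBlocks w a b c j n₁
  set ma := midBlocks w a b c (j + n₁) n₂
  set mb₂ := midBlocks w a b c (j + (n₁ + n₂)) n₃
  set rd := wR w s(c (j + d), c (j + d + 1))
  set u := conv (edgeBC (wR w s(b, c j))) (blockIn q w a b c j)
  set s := conv (restVec q w a b c (j + d + 1) (m - (j + d + 1))) (edgeAC (wR w s(a, c (j + d + 1))))
  have hrd0 : 0 ≤ rd := (w _).2.1
  have hrd1 : rd ≤ 1 := (w _).2.2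
  set F := fanVec q ma fanInit
  set G₁ := fanVecB q mb₁ fanInit
  set G₂ := rimStep q rd (fanVecB q mb₂ fanInit)
  have hF : InKE q F := fanVec_inKE (unitBlocks_midBlocks w a b c (j + n₁) n₂) (fanInit_inKE q)
  have hG₁ : InKE q G₁ := fanVecB_inKE (unitBlocks_midBlocks w a b c j n₁) (fanInit_inKE q)
  set X : ℝ → V5 := fun σ => fanCombo q F (fanComboB q G₁ (conv (edgeAC σ) u))
  set Y : ℝ → V5 := fun τ => fanComboBrev q G₂ (conv s (edgeBC τ))
  have hZ : ∀ σ τ : ℝ, crossFarZ q (midBlocks w a b c j d) rd u s σ τ = val q (conv (Y τ) (X σ)) := by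
    intro σ τ; rw [hsplit]; exact crossFarZ_bab q hx1 hy2 hx3 rd u s σ τ
  have hmem : wedgeH (X 0) (X 1) ∈ mfAtomSet q := hBA F G₁ u hF hG₁ huK
  have hpos : ∀ β, β ∈ mfAtomSet q → 0 ≤ pairH q β (wedgeH (Y 0) (Y 1)) :=
    pairH_mfAtomSet_bTarget hq0 hq1 (unitBlocks_midBlocks w a b c (j + (n₁ + n₂)) n₃) hx3 hrd0 hrd1 hsK
  have key := rayleigh_of_isOpCone hmem hpos
  have e : ∀ A B : V5, conv A B = conv B A := fun A B => by simp only [← mul_def]; ac_rfl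
  simp only
  rw [hZ, hZ, hZ, hZ, e (Y 1) (X 1), e (Y 0) (X 0), e (Y 0) (X 1), e (Y 1) (X 0)]
  linarith [key]

end Setting

end ThreeApex

end FK

end Summit.CriticalPhenomena.PercolationContinuityZ3.Theorems
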